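import Literature.AnabelianGeometry.EtaleTheta.ThetaCoversTemperedOfSetting
import Literature.AnabelianGeometry.EtaleTheta.Discharge.Sec2ThetaSubquotientNormal
import HarnessLib

/-!
# [EtTh] §2 Def. 2.7 at the §1 model: the DECIDABLE fields of abc-iut-L2-t2's `OrbitEmbedding` for the assembled
# cover, as standalone identities (proof-only; the `map_Huu` field stays census-blocked, C10)

Mochizuki, *The étale theta function and its Frobenioid-theoretic manifestations*, Publ. RIMS **45**
(2009), §2, Def. 2.7 p. 41, Def. 2.1 p. 36 ("`Π_X ⊆ Π_C`", the augmentations to `G_K`)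
[cite: MochizukiEtTh2009, Def 2.7 p.41].

Cell abc-iut, layer L2, seat abc-iut-L2-d3 (gen 5). PROOF-ONLY (0 defs). abc-iut-L2-t2's parameter bundle
`DoubleUnderline.OrbitEmbedding C T` (ThetaRootOrbitsOfSetting) asks, for `ι := M.inclX` and
`T := MuTwoSetting.CLevelData.temperedCoverData …`: `injective_ι` (= `M.injective_inclX`), `map_GtpYdd` (`rfl`,
`temperedCoverData_tempered`), `normal_top` / `normal_bot` (abc-iut-L2-d3 gen 4, `Sec2ThetaSubquotientNormal`,
p430305), `gk`/`aug_ι` (THIS file: `gk := MulEquiv.refl`, `temperedCoverData_aug_toHat_inclX`), the data `tau`,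
`tauInv`, and `map_Huu` — the ONLY field not decidable at the model (13:00Z census C10: needs abc-iut-L2-t8's
`DoubleUnderline` v-next clauses «ι-compatibility» (Def. 2.5 (i)(b)) and cusp-adaptedness). Consumers (R247,
abc-iut-w6-d049/051/083 outer-γ capstones) can cite the model-side identities below BY NAME.
[EtTh] is refereed; no side is taken on [IUTchIII] Cor. 3.12; typed ≠ proved elsewhere.
-/

namespace Literature.AnabelianGeometry.EtaleTheta

open Literature.AnabelianGeometry.SemiGraphs ThetaCovers
open _root_.Topology

namespace MuTwoSetting.CLevelData

variable {p : ℕ} [Fact p.Prime] {M : MuTwoSetting p}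
variable {PC : Type} [Group PC] [TopologicalSpace PC] [IsTopologicalGroup PC] [T2Space PC]

section Binders

variable (e : M.CLevelData) (ιC : M.GtpC →ₜ* PC)
    (hιC : IsProfiniteCompletion ιC) (hinj : Function.Injective ιC) (op : M.toThetaSetting.OncePuncturedData)
    {l : ℕ} (hodd : Odd l) {x : M.Pt} (hx : M.IsCusp x)
    (hIx : ((e.piCDataOf ιC hιC).Dx x ⊓ (e.piCDataOf ιC hιC).augGK.ker) ⊔ (e.piCDataOf ιC hιC).barKer l =
      (e.piCDataOf ιC hιC).barTheta l)
    (hιell : ∀ c ∈ (e.piCDataOf ιC hιC).augGK.ker, c ∉ (e.piCDataOf ιC hιC).PiX →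
      ∀ d ∈ (e.piCDataOf ιC hιC).PiX ⊓ (e.piCDataOf ιC hιC).augGK.ker,
        c * d * c⁻¹ * d ∈ (e.piCDataOf ιC hιC).barTheta l)
    (hN : ((M.GtpXu l).map M.inclX).Normal) (hY : (M.GtpY.map M.inclX).Normal) {S : Subgroup PC}
    (hS : ((e.piCDataOf ιC hιC).coverDataAx l op hx hodd hIx hιell
        ((e.piCDataOf ιC hιC).inv_theta_of_inv_ell l op hιell)).toCoverData.IsSplitting S)
    (hSc : IsClosed (S : Set PC))

/-- **`OrbitEmbedding.aug_ι` at the model with `gk := MulEquiv.refl`**: the composite augmentation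
`Π^tp_X → Π^tp_C → Π_C → G_K` of the assembled cover is the §1 augmentation (`piCDataOf_aug_inclX`).
[cite: MochizukiEtTh2009, Def 2.1 p.36] -/
theorem temperedCoverData_aug_toHat_inclX (g : M.PiTemp) :
    (e.temperedCoverData ιC hιC hinj op hodd hx hIx hιell hN hY hS hSc).aug
        ((e.temperedCoverData ιC hιC hinj op hodd hx hIx hιell hN hY hS hSc).toHat (M.inclX g)) =
      (MulEquiv.refl ↥M.GK) ⟨M.aug g, M.aug_mem_GK g⟩ := by
  apply Subtype.ext
  show (((e.piCDataOf ιC hιC).augGK (ιC (M.inclX g)) : M.GK) : GQp p) = M.aug g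
  rw [ThetaSetting.PiCData.coe_augGK_apply, e.piCDataOf_aug_inclX]

/-- The kernel of the composite augmentation restricted along `inclX` is `Δ^tp_X`: `g ∈ Δ^tp_X` iff
`aug(toHat(inclX g)) = 1`. [cite: MochizukiEtTh2009, Def 2.1 p.36] -/
theorem temperedCoverData_aug_toHat_inclX_eq_one_iff (g : M.PiTemp) :
    (e.temperedCoverData ιC hιC hinj op hodd hx hIx hιell hN hY hS hSc).aug
        ((e.temperedCoverData ιC hιC hinj op hodd hx hIx hιell hN hY hS hSc).toHat (M.inclX g)) = 1 ↔
      g ∈ M.DeltaTemp := by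
  rw [temperedCoverData_aug_toHat_inclX, MulEquiv.refl_apply]
  change _ ↔ M.aug.toMonoidHom g = 1
  constructor
  · intro h
    exact congrArg Subtype.val h
  · intro h
    exact Subtype.ext h

/-- **`OrbitEmbedding.map_GtpYdd` / the `Π^tp_Ÿ`-member at the model** (`rfl`) and `injective_ι` (bookkeeping for
consumers). [cite: MochizukiEtTh2009, Def 2.7 p.41] -/
theorem temperedCoverData_map_GtpYdd :
    M.GtpYdd.map M.inclX = (e.temperedCoverData ιC hιC hinj op hodd hx hIx hιell hN hY hS hSc).PiYddtp ∧
      Function.Injective M.inclX :=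
  ⟨rfl, M.injective_inclX⟩

/-- **`OrbitEmbedding.normal_top` / `normal_bot` at the model** (abc-iut-L2-d3 gen 4, p430305, re-exported in the
`T`-vocabulary: `T.Gtp = Π^tp_C`). [cite: MochizukiEtTh2009, Def 2.7 p.41] -/
theorem temperedCoverData_normal_top_bot :
    ((M.DeltaTheta.comap M.toTheta).map M.inclX :
        Subgroup (e.temperedCoverData ιC hιC hinj op hodd hx hIx hιell hN hY hS hSc).Gtp).Normal ∧
      ((M.toTheta.ker.map M.inclX :
        Subgroup (e.temperedCoverData ιC hιC hinj op hodd hx hIx hιell hN hY hS hSc).Gtp).Normal) :=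
  ⟨e.map_inclX_comap_deltaTheta_normal, e.map_inclX_ker_toTheta_normal⟩

end Binders

end MuTwoSetting.CLevelData

end Literature.AnabelianGeometry.EtaleTheta
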